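import Summits.MatrixMultiplication.MatrixMultiplication.Theses.FourierTwoFamiliesModP

/-!
# Exclusion zones, pattern diversity, induced blocks; paradigm notes

Crux `FourierTwoFamiliesModP.PrimeDensityDecay` (stmt-MatrixMultiplication-14311), refuter / crux-disprover lane
(`Theorems/PrimeDensityDecay/Negative/`).  `exclusion_zone` ((W)+(X) ⇒ `b + (a − a') ∉ B_k`), `common_pattern_bound` / `A_translates_bound` / `pattern_multiplicity_bound` (at most `p/(s|E|)` blocks contain a translate of a pattern `E`), `induced_block` (`{y ∈ Y : x − y ∈ D} = B_i` for `x ∈ A_i`), and the PARADIGM NOTES module doc block (why eight construction classes stay far from positive density).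
These are the landed copies of the sections of the standing disproof work file
`Cruxes/PrimeDensityDecay/Disproof.lean` (same statements and proofs, namespace `…Negative.Disproof`); no theorem here
asserts a Theses decl positively.
-/

namespace Summit.MatrixMultiplication.MatrixMultiplication.Theorems.PrimeDensityDecay.Negative.Disproof

open Finset
open Summit.MatrixMultiplication.MatrixMultiplication.Theses.FourierTwoFamiliesModP

/-! ## (c') Exclusion zones and the common-pattern bound (stronger than the translate bound) -/

/-- EXCLUSION ZONES.  Under (W)+(X): for every block `i`, every `b ∈ B_i` and all `a ≠ a'` in `A_i`,
the point `b + (a − a')` lies in NO block `B_k` (neither `k = i`, by (W), nor `k ≠ i`, by (X) with the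
index pattern `(i,i,i,k)`).  Dually `a + (b − b') ∉ A_k`.  So around each `B_i` the set
`B_i + (A_i − A_i)∖{0}` (size `≥ s² − s`) is free of `Y = ⋃ B_k`: density `> 1/s` forces these zones to
overlap heavily (`Σ_i |zone_i| ≈ n s² > p`, the WallBreach regime). -/
theorem exclusion_zone {p n : ℕ} (A B : Fin n → Finset (ZMod p))
    (hW : ∀ i : Fin n, ∀ a ∈ A i, ∀ a' ∈ A i, ∀ b ∈ B i, ∀ b' ∈ B i,
      (a - a') + (b - b') = 0 → a = a' ∧ b = b')
    (hX : ∀ i j k : Fin n, ∀ a ∈ A i, ∀ a' ∈ A j, ∀ b ∈ B j, ∀ b' ∈ B k,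
      (a - a') + (b - b') = 0 → i = k)
    (i k : Fin n) {a a' b : ZMod p} (ha : a ∈ A i) (ha' : a' ∈ A i) (hb : b ∈ B i) (hne : a ≠ a') :
    b + (a - a') ∉ B k := by
  intro hb'
  have hik : i = k := hX i i k a ha a' ha' b hb (b + (a - a')) hb' (by ring)
  subst hik
  exact hne (hW i a ha a' ha' b hb (b + (a - a')) hb' (by ring)).1

/-- (X) alone makes the `B`-blocks pairwise disjoint (pattern `(i,i,i,k)` with `a = a'`), provided the
`A`-blocks are nonempty. -/
theorem B_disjoint {p n : ℕ} (A B : Fin n → Finset (ZMod p))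
    (hX : ∀ i j k : Fin n, ∀ a ∈ A i, ∀ a' ∈ A j, ∀ b ∈ B j, ∀ b' ∈ B k,
      (a - a') + (b - b') = 0 → i = k)
    (hA : ∀ i, (A i).Nonempty) {i k : Fin n} (hik : i ≠ k) : Disjoint (B i) (B k) := by
  rw [Finset.disjoint_left]
  intro b hbi hbk
  obtain ⟨a, ha⟩ := hA i
  exact hik (hX i i k a ha a ha b hbi b hbk (by ring))

/-- COMMON-PATTERN BOUND.  If every `A`-block contains a translate of one pattern `E`
(`t_i + E ⊆ A_i`), the `B`-blocks being ARBITRARY `s`-sets, then (W)+(X) force `n·s·|E| ≤ p`: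
`Y = ⋃ B_i` has `n s` elements and `(y, e) ↦ y + e` is injective on `Y × E` by `exclusion_zone`.
With `E = A` (all `A_i` translates of one `s`-set) this is `n s² ≤ p`, density `≤ 1/s`, whatever the
`B_i` are; with `|E| = 2` it says: blocks sharing one internal difference `d` fill density `≤ 1/2`.
Robust form: for any pattern `E`, at most `p/(s|E|)` blocks of an SDPP family contain a translate
of `E` (apply the bound to that sub-family). -/
theorem common_pattern_bound {p : ℕ} [NeZero p] {n s : ℕ} (A B : Fin n → Finset (ZMod p))
    (E : Finset (ZMod p)) (t : Fin n → ZMod p)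
    (hB : ∀ i, (B i).card = s) (hE : ∀ i, E.image (t i + ·) ⊆ A i)
    (hW : ∀ i : Fin n, ∀ a ∈ A i, ∀ a' ∈ A i, ∀ b ∈ B i, ∀ b' ∈ B i,
      (a - a') + (b - b') = 0 → a = a' ∧ b = b')
    (hX : ∀ i j k : Fin n, ∀ a ∈ A i, ∀ a' ∈ A j, ∀ b ∈ B j, ∀ b' ∈ B k,
      (a - a') + (b - b') = 0 → i = k) :
    n * s * E.card ≤ p := by
  classical
  rcases E.eq_empty_or_nonempty with hE0 | ⟨e₀, he₀⟩
  · simp [hE0]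
  have hAne : ∀ i, (A i).Nonempty := fun i => ⟨t i + e₀, hE i (Finset.mem_image.mpr ⟨e₀, he₀, rfl⟩)⟩
  set Y : Finset (ZMod p) := Finset.univ.biUnion B with hYdef
  have hYcard : Y.card = n * s := by
    have hdisj : Set.PairwiseDisjoint (↑(Finset.univ : Finset (Fin n))) B :=
      fun i _ k _ hik => B_disjoint A B hX hAne hik
    rw [hYdef, Finset.card_biUnion hdisj]
    simp [hB]
  -- the map (y, e) ↦ y + e is injective on Y × E
  set YE : Finset (ZMod p) := (Y ×ˢ E).image (fun ye : ZMod p × ZMod p => ye.1 + ye.2) with hYEdef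
  have hYE : YE.card = n * s * E.card := by
    rw [hYEdef, Finset.card_image_of_injOn, Finset.card_product, hYcard]
    rintro ⟨y, e⟩ hye ⟨y', e'⟩ hye' h
    simp only [Finset.coe_product, Set.mem_prod, Finset.mem_coe] at hye hye'
    have h' : y + e = y' + e' := h
    obtain ⟨⟨hy, he⟩, ⟨hy', he'⟩⟩ := And.intro hye hye'
    rw [hYdef, Finset.mem_biUnion] at hy hy'
    obtain ⟨i, -, hyi⟩ := hy
    obtain ⟨k, -, hyk⟩ := hy'
    by_cases hee : e = e'
    · subst hee
      have : y = y' := add_right_cancel h'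
      subst this
      rfl
    · exfalso
      have hmem : y + ((t i + e) - (t i + e')) ∈ B k := by
        have : y + ((t i + e) - (t i + e')) = y' := by linear_combination h'
        rw [this]; exact hyk
      refine exclusion_zone A B hW hX i k (hE i ?_) (hE i ?_) hyi ?_ hmem
      · exact Finset.mem_image.mpr ⟨e, he, rfl⟩
      · exact Finset.mem_image.mpr ⟨e', he', rfl⟩
      · intro h2; exact hee (add_left_cancel h2)
  have hle : YE.card ≤ Fintype.card (ZMod p) := Finset.card_le_univ _
  rwa [ZMod.card, hYE] at hle

/-- The translate bound again, now with ARBITRARY `B`-blocks: all `A_i = t_i + A` ⇒ `n s² ≤ p`. -/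
theorem A_translates_bound {p : ℕ} [NeZero p] {n s : ℕ} (A₀ : Finset (ZMod p)) (t : Fin n → ZMod p)
    (A B : Fin n → Finset (ZMod p)) (hA₀ : A₀.card = s) (hA : ∀ i, A i = A₀.image (t i + ·))
    (hB : ∀ i, (B i).card = s)
    (hW : ∀ i : Fin n, ∀ a ∈ A i, ∀ a' ∈ A i, ∀ b ∈ B i, ∀ b' ∈ B i,
      (a - a') + (b - b') = 0 → a = a' ∧ b = b')
    (hX : ∀ i j k : Fin n, ∀ a ∈ A i, ∀ a' ∈ A j, ∀ b ∈ B j, ∀ b' ∈ B k,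
      (a - a') + (b - b') = 0 → i = k) :
    n * s ^ 2 ≤ p := by
  have h := common_pattern_bound A B A₀ t hB (fun i => (hA i).symm ▸ le_refl _) hW hX
  rw [hA₀] at h
  simpa [sq, mul_assoc] using h


/-! ## (c'') Quantitative pattern diversity and the induced-block identity -/

/-- PATTERN MULTIPLICITY BOUND (robust form of `common_pattern_bound`): in ANY family satisfying
(W)+(X) with `|B_i| = s`, the blocks whose `A`-set contains a translate of a fixed pattern `E` are
at most `p / (s·|E|)` in number.  So a family of density `α = ns/p` has at most a fraction
`1/(α·|E|)` of its blocks sharing any `|E|`-point pattern: dense designs are pattern-diverse at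
scale `1/α` (no common AP piece, no common digit box, … of more than `1/α` points). -/
theorem pattern_multiplicity_bound {p : ℕ} [NeZero p] {n s : ℕ} (A B : Fin n → Finset (ZMod p))
    (E : Finset (ZMod p)) (t : Fin n → ZMod p) (S : Finset (Fin n))
    (hB : ∀ i, (B i).card = s) (hE : ∀ i ∈ S, E.image (t i + ·) ⊆ A i)
    (hW : ∀ i : Fin n, ∀ a ∈ A i, ∀ a' ∈ A i, ∀ b ∈ B i, ∀ b' ∈ B i,
      (a - a') + (b - b') = 0 → a = a' ∧ b = b')
    (hX : ∀ i j k : Fin n, ∀ a ∈ A i, ∀ a' ∈ A j, ∀ b ∈ B j, ∀ b' ∈ B k,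
      (a - a') + (b - b') = 0 → i = k) :
    S.card * s * E.card ≤ p := by
  classical
  -- restrict the family to the index set S, reindexed by Fin S.card
  set e := S.equivFin with he
  let ι : Fin S.card → Fin n := fun m => (e.symm m).1
  have hι : ∀ m, ι m ∈ S := fun m => (e.symm m).2
  have hιinj : Function.Injective ι := by
    intro m m' h
    exact e.symm.injective (Subtype.ext h)
  have h := common_pattern_bound (p := p) (n := S.card) (s := s)
    (fun m => A (ι m)) (fun m => B (ι m)) E (fun m => t (ι m))
    (fun m => hB (ι m)) (fun m => hE (ι m) (hι m))
    (fun m => hW (ι m))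
    (fun m m' m'' a ha a' ha' b hb b' hb' hrel => hιinj (hX (ι m) (ι m') (ι m'') a ha a' ha' b hb b' hb' hrel))
  simpa using h

/-- INDUCED-BLOCK IDENTITY: for `x ∈ A_i`, the elements `y ∈ Y = ⋃ B_k` with `x − y ∈ D = ⋃_j (A_j − B_j)`
are EXACTLY `B_i` ((X) with the pattern `(i, j, j, k)`).  Hence `Y` meets every translate `x − D`,
`x ∈ X`, in `s` points although `|D| ≥ s²` by (W): relative density `≤ 1/s` of `Y` on `X − D`, the
`1/s`-porosity that every increment argument starts from. -/
theorem induced_block {p n : ℕ} (A B : Fin n → Finset (ZMod p))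
    (hX : ∀ i j k : Fin n, ∀ a ∈ A i, ∀ a' ∈ A j, ∀ b ∈ B j, ∀ b' ∈ B k,
      (a - a') + (b - b') = 0 → i = k)
    (i : Fin n) {x : ZMod p} (hx : x ∈ A i) :
    (Finset.univ.biUnion B).filter
        (fun y => ∃ j : Fin n, ∃ a' ∈ A j, ∃ b'' ∈ B j, x - y = a' - b'') = B i := by
  classical
  ext y
  simp only [Finset.mem_filter, Finset.mem_biUnion, Finset.mem_univ, true_and]
  constructor
  · rintro ⟨⟨k, hyk⟩, j, a', ha', b'', hb'', hrel⟩
    have hik : i = k := hX i j k x hx a' ha' b'' hb'' y hyk (by linear_combination hrel)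
    subst hik
    exact hyk
  · intro hy
    exact ⟨⟨i, hy⟩, i, x, hx, y, hy, rfl⟩

/-! ## PARADIGM NOTES (paper analysis; no declaration)

PARADIGM NOTES (why each known construction class stays far from density `ε₀ > 0`).
Write `X = ⊔ A_i`, `Y = ⊔ B_i`, `D = ⋃_j (A_j − B_j)`; (X) ⇔ `(A_i − B_k) ∩ D = ∅ (i ≠ k)`.
1. Translates / common `A`-pattern: `common_pattern_bound` (Lean) — density `≤ 1/|E|`.
2. Common difference set (`A_i − B_i = D₀ ∀ i`, e.g. all digit factorisations
   `[0,s²) = Box(S) + Box(Sᶜ)`): cross sets `Box(S_i)+Box(S_kᶜ)` have no gap of length `s²`, so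
   offsets must be `≥ 2s²` apart: density `≤ 1/(2s)`.
3. 2-D segments (`A_i` vertical, `B_i` horizontal in `ℤ/M₁ × ℤ/M₂`): (X) for the pair `(i,k,k)`
   forces the base points to be `s`-separated in sup-norm: `n ≤ M₁M₂/s²`, density `≤ 1/s`.
4. Product alphabets in `(ℤ/M)^m` (letters `(P,Q)`, `P ⊖ Q` direct; code condition
   `∀ w ≠ w' ∀ w'' ∃ c, (P_{w_c} − Q_{w'_c}) ∩ (P_{w''_c} − Q_{w''_c}) = ∅`): contains CKSU Prop 4.5
   (Sperner/antichain codes) and its translates (a subgroup `U` of translations is the same as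
   `M ↦ M/|U|`).  Balance pins the composition class; near-full rate for a whole class would make
   the alphabet itself an SDPP family of density `1` in `ℤ/M` — impossible — so rate `< log M`
   strictly and density decays exponentially in `m`, polynomially in `s`.  Records: all-abelian
   `(8/9)^l/√l ≈ s^(-0.17)` (`M = 3`), cyclic (digits `{2..M-1}`, carries absorbed at a zero digit)
   `≈ s^(-0.546)` (`M ≈ 9`).
5. Line designs in `(ℤ/M)^k` (`A_i`, `B_i` coordinate lines, `s = M − 1`): `n ≈ εM^(k-1)` lines
   are needed but a line's base point has two forced zeros, so `k² M^(k-2) ≥ εM^(k-1)`, `k ≳ √(εM)`;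
   with `b_i = a_i − 𝟙` off the two directions, same-direction-pair blocks need a distance-3 code
   (Hamming: fine, density `≈ k/M²` if `k ≈ εM²`), but every base point then has `≈ M⁷` partners at
   Hamming distance `≤ 4` in each other direction pair, each of which must be rescued by a zero /
   `−1` coincidence; global parity checks of redundancy `r` push `k` to `M^(r+1)` and the number of
   dangerous partners to `M^(r+6)`.  The sparse (matching) variant with entries in `{2..M-1}` is
   clean but has density `(k/2M³)(1−2/M)^k → 0`.
6. Multiplicative designs in `F_p` (blocks = cosets/dilates under `Γ ≤ F_p^×`): (X) needs the
   `Γ`-classes of `1 − uΓ` and of `1 − u(X∖Γ)` to be disjoint, but `|X∖Γ| ≫ (p−1)/|X|` classes are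
   all hit (cyclotomic numbers `p/r² + O(√p)`), so `D` meets everything.
7. Random / greedy: representation counts `α²p|D| ≫ αps` — hopeless by a factor `αs`.
8. Two-level designs (a base family `ℱ₀ = {(A_τ,B_τ)}_{τ<L}` replicated along a shift set `Λ`,
   blocks `(A_τ + t, B_τ + t)`): valid iff `ℱ₀` is SDPP and `(Λ − Λ)∖0` avoids
   `F = D₀ + Y₀ − X₀ ⊇ (A_τ+B_τ) − (A_τ+B_τ)`, so `|Λ| ≤ p/s²` (packing), density `≤ L/s`, hence
   `L ≳ εs` base blocks; if `ℱ₀` sits in a window of length `W` then `Λ` is `2W`-separated, forcing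
   `W ≈ s²` and a base family of density `≈ 2ε` with `n₀ = L ≈ εs ≤ K·s₀` blocks — the REMOVAL
   REGIME, where decay is proved (support item RemovalRegime).  So flat two-level replication
   provably fails asymptotically; porous `F` means a multi-scale base, i.e. digit designs (item 4).
Necessary features of a counterexample: `n/s → ∞`, `s² = o(p)`, `Σ_i |B_i + (A_i−A_i)| ≈ ns² ≫ p`
with heavily overlapping exclusion zones, block patterns diverse at scale `1/ε`, and `D` biased
(`|μ̂_D(ξ)| ≥ α − 1/s` at some `ξ ≠ 0`, from `1_Y ∗ μ_{−D} ≤ 1/s` on `X`). -/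

end Summit.MatrixMultiplication.MatrixMultiplication.Theorems.PrimeDensityDecay.Negative.Disproof
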